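import Summits.BirchSwinnertonDyer.Rank1Residual.Supersingular.X6RankOneStepL
import Summits.BirchSwinnertonDyer.Rank1Residual.Supersingular.KobayashiMainConjectureX7
import Summits.BirchSwinnertonDyer.Rank1Residual.Supersingular.GoodSSTowerOfSurj
import Summits.BirchSwinnertonDyer.Rank1Residual.X11b.Three.KolyvaginNonvanishing
import HarnessLib

/-!
# Class X7 (good supersingular `p ≥ 5`, `E` NOT semistable), analytic rank `1`: the KOLYVAGIN /
# LEVEL-RAISING road — the lower half of `BSD(E,p)` from W. Zhang's Kolyvagin non-vanishing AT A
# SUPERSINGULAR PRIME (typed missing input), everything else published by name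
# (cell `bsd-ssimc`, seat `bsd-ssimc-lev` = bipartite Euler system / level-raising, gen 0)

HONEST FRAMING (cell `bsd-ssimc`, `run/shared/lean/pub/bsd-ssimc/README.md`, FULL-BSD rank ≤ 1
programme D-0036 tranche 1b, row A7 = X7 = N5 (r = 0) / O4 (r = 1)): this file TYPES a missing
input and proves REDUCTIONS; it asserts nothing about any curve, books nothing, moves no label
(X7 stays CONSTRUCTION-SHAPED; the referee rules). No `sorry`; ONE definition (the typed missing
input `ZhangKolyvaginNonvanishingSS`, `@[conjecture]`, our obligation — NOT a Literature fact: it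
is NOT in print) and theorems that are pure compositions of decls already in the tree.

## What the level-raising road gives for X7, and what it needs (memo `HOME/bsd-ssimc-lev/MEMO-1.md`)

The cell's map types O4 (X7 ∧ r_an = 1, 1 172 open cells of record) as NEEDS X_B2 = Kobayashi's
signed main conjecture EQUALITY at non-square-free `N` (`KobayashiMainConjecture W p ε`) + BKO 2024
Cor. A.5 (`bsdp_of_kobayashiMainConjecture_of_corA5_of_analyticRank_eq_one`). On the Kolyvagin road
the LOWER half of `BSD(E,p)` needs NO main conjecture: W. Zhang, Camb. J. Math. 2 (2014) proves
Kolyvagin's conjecture (`c_1(n) ≠ 0` for some `n ∈ Λ`, i.e. McCallum's `M_∞ = 0`) under (1) `ρ̄_{E,p}`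
onto, (2)–(3) = Hypothesis ♠, (4) `p` good ORDINARY — and LOCALISES (4) himself: p. 231, §7.1,
verbatim: "We need the results of Kato and Skinner–Urban on the B-SD formula in the rank zero case.
This is the only place we need to impose the ordinariness assumption. … Remark 15. We will only use
that the left hand side is at most as large as the right hand side in (7.1)" — i.e. ONLY the
rank-`0` LOWER-BOUND inequality `v_𝔭(L(g/K,1)/Ω_g^can) ≤ lg Sel_{𝔭^∞}(A_g/K) + Σ t_g(ℓ)` for the
LEVEL-RAISED weight-2 newforms `g` (levels `N·q₁⋯q_r`, `q_i` admissible) congruent to `f_E`. The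
same localisation is printed for the supersingular anticyclotomic theory: Burungale–Büyükboduk–Lei,
arXiv:2310.06813 (BBL II) Thm. 6.16 (i)–(ii) hold for ANY conductor `N₀` while (iii)/Prop. 6.17
("Suppose also that the level `N₀` is square-free") import "the `p`-adic BSD conjecture, as
established [footnote: These results require the level to be square-free] in [BSTW], [CCSS] and
[FW21]" for the trivial-Selmer level-raised form `g`; and C.-H. Kim, TAMS 377 (2024)
= arXiv:2203.12161, Remark 2.1 / Thm. 2.5 (structure of `Sel(K,E[p^∞])` from the bipartite Euler
system, `N⁺` ARBITRARY, no ordinarity) with §7 (non-triviality ⟸ the main conjecture at the trivial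
character). So on this road the WHOLE of X7 at `p ≥ 5` (both ranks) reduces to ONE rank-`0`,
trivial-`𝔭`-Selmer, mod-`𝔭` statement for level-raised forms of NON-square-free level at a
NON-ordinary `𝔭` — strictly smaller than X_B2, and for `p ≥ 5` not reachable by any congruence
(level raising/lowering never removes an additive prime: `cond(ρ̄_{E,p}) = cond(ρ_{E,p})` at every
additive `ℓ ≠ p` when `p ≥ 5`, memo §2). THIS FILE types the Zhang-shaped conclusion at a
supersingular prime and proves what it buys in the tree's currency.

## Contents (every symbol a tree object)

* `ZhangKolyvaginNonvanishingSS` — TYPED MISSING INPUT (`@[conjecture]`): W. Zhang 2014 Thm. 1.1 at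
  `N⁻ = 1` with hypothesis (4) "ordinary" REPLACED by "supersingular" (`p ∣ a_p`), binder for binder
  the tree's cited fact `WZhang2014_exists_kolyvaginClass_one_ne_zero` (cell `bsd-stepL`, seat koly).
  NOT in print; our obligation. Census (this seat, kit j239648, S-b v4f): of the 3 848 X7 pairs at
  `p ≥ 5` (r0 568 / r1 3 280), 3 474 (90.3 %; r1: 3 130 of 3 280) satisfy (1)–(3) — ONLY (4) fails;
  of the 1 098 still-open `p ≥ 5` cells (book230 classes), 905.
* `X7.ZhangShapeAt` — the census predicate (1) ∧ ♠(1) ∧ ♠(2) at `N⁻ = 1` (bookkeeping `def`-free: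
  an `abbrev`-free conjunction spelled inside the theorems; no definition).
* `X7.exists_indexLowerBoundAt_of_zhangSS_of_mccallum` — the typed input + McCallum 1991 Cor. 5.6
  (cited fact `McCallum1991_pow_dvd_card_sha_primary_of_certificate`) ⇒ STEP L
  `X11b.IndexLowerBoundAt W p K P` for the Heegner point of the input's normalisation — the
  supersingular twin of `Koly.exists_indexLowerBoundAt_of_zhang2014_of_mccallum` (STEP-0 of seat
  `bsd-stepL-koly`, ORDINARY), same proof.
* `X7.missingLowerBoundAt_of_indexLowerBoundAt_of_surj` — STEP L at a Manin-unit Heegner datum ⇒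
  `Typed.MissingLowerBoundAt W p` on X7 ∧ r_an = 1 ∧ `p ≥ 5` ∧ surj(p): the X7 reading of
  `X6.missingLowerBoundAt_of_indexLowerBoundAt` (there surjectivity is AUTOMATIC, Serre Prop. 21 for
  semistable `E`; here it is a hypothesis — the census has it on 3 279 of 3 280 r1 pairs).
* `X7.missingLowerBoundAt_of_stepL_of_surj` — class level (field by Friedberg–Hoffstein, datum by
  Mazur 1978 + Néron, as in the X6 file).

What is NOT here: the identification of Zhang's `P_1 = y_K` (the input's normalisation) with the
tree's `heegnerPointComplex Dt H` of a Manin-unit datum — the same seam the `bsd-stepL-koly` file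
leaves ("the other half of Lemma 5.1 … is the caller's"); the UPPER half in rank `1` at a
supersingular prime of a non-semistable curve (not in print: Sprung 2024 Cor. 1.3 / BSTW are
semistable; Kato–Kobayashi–Perrin-Riou give it only via the binder of `SignedRankOneLinkBKO`); the
rank-`0` road (N5) — per pair it is `Additive.X4RankZeroLowerKolyvaginDerived`'s certificate route
verbatim (reduction-agnostic), class-wide it needs the same typed input for the rank-one twist.

References: W. Zhang 2014 [WZhang2014] Thm. 1.1 (p. 195), ♠ (pp. 194–195), §7.1 Thm. 7.1 +
Remarks 14–15 (pp. 231–232), Thm. 10.2/10.3; McCallum 1991 [McCallumLMS1991] §5 Cor. 5.6;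
Burungale–Büyükboduk–Lei arXiv:2310.06813 Thm. 1.3/6.16, Prop. 6.17; C.-H. Kim arXiv:2203.12161
Rem. 2.1, Thm. 2.5, Thm. 5.21, §7; BSTW arXiv:2409.01350v2 Thm. 1.24, §2.3 (p. 76: "Since `g` is
semistable, there exists a prime `q ∣ N` satisfying the condition (ram) by Ribet's level raising");
JSW 2017 §7.4.1; Wuthrich 2014 Prop. 21; Serre 1972 Prop. 21; Mazur 1978 Cor. 4.1.
-/

noncomputable section

open scoped Classical MatrixGroups ModularForm

open CongruenceSubgroup WeierstrassCurve NumberField Literature.NumberTheory.EllipticCurves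
  Literature.NumberTheory.EllipticCurves.ModularForms
  Literature.NumberTheory.EllipticCurves.Rank1Residual
  Literature.NumberTheory.EllipticCurves.Rank1Residual.Typed
  Literature.NumberTheory.EllipticCurves.Wuthrich2014
  Summit.BirchSwinnertonDyer.Rank1Residual.X11b.Three.Koly

namespace Summit.BirchSwinnertonDyer.Rank1Residual.Supersingular

/-! ### §1 The typed missing input: Zhang's Kolyvagin non-vanishing at a SUPERSINGULAR prime -/

/-- **TYPED MISSING INPUT — Kolyvagin's conjecture (W. Zhang's mod-`p` form, `N⁻ = 1`) at a good
SUPERSINGULAR prime `p ≥ 5`.** W. Zhang, Camb. J. Math. 2 (2014) Thm. 1.1 (p. 195) proves, for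
`E/ℚ` of conductor `N` (ANY `N`), `K` imaginary quadratic with every `ℓ ∣ N` split and `p ∤ d_K`,
`p ≥ 5` with (1) `ρ̄_{E,p}` onto, ♠(1) every `ℓ ∥ N` has `ρ̄_{E,p}` ramified (`p ∤ v_ℓ(Δ_min)`),
♠(2) if `N` is not square-free there are two primes `ℓ ∥ N`, and (4) `p` good ORDINARY: "`c_1(n) ≠ 0`
for some `n ∈ Λ`". THIS `Prop` is the same sentence with (4) replaced by "`p` good SUPERSINGULAR"
(`p ∣ a_p`, i.e. `a_p = 0` for `p ≥ 5`), binder for binder the tree's cited fact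
`WZhang2014_exists_kolyvaginClass_one_ne_zero`. It is NOT IN PRINT and is NOT a Literature fact: by
Zhang's own localisation (p. 231: "This is the only place we need to impose the ordinariness
assumption … Remark 15. We will only use that the left hand side is at most as large as the right
hand side in (7.1)") it follows from his §§3–6, 8–9 verbatim plus ONE input — the rank-`0` LOWER
bound `v_𝔭(L(g/K,1)/Ω_g^can) ≤ lg_𝒪 Sel_{𝔭^∞}(A_g/K) + Σ_{ℓ∣N_g} t_g(ℓ)` for the level-raised
weight-2 newforms `g ≡ f_E (mod 𝔭)` of level `N·q₁⋯q_r` at the NON-ordinary prime `𝔭` — which is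
in print only for square-free level (BSTW 2024 Thm. 1.5 / CCSS / FW21, as recorded verbatim by
Burungale–Büyükboduk–Lei arXiv:2310.06813 Prop. 6.17 and its footnote). OPEN; our obligation;
nothing asserted. [cite: WZhang2014, Thm. 1.1 (p. 195), Hypothesis ♠ (pp. 194–195), §7.1 (p. 231) and Remark 15 (p. 232) (shape only; nothing asserted)] -/
@[conjecture] def ZhangKolyvaginNonvanishingSS : Prop :=
  ∀ (W : WeierstrassCurve ℚ) [W.IsElliptic] [W.IsGloballyMinimal] (p : ℕ) [hp : Fact p.Prime],
    5 ≤ p → W.HasGoodReductionAtPrime p → (p : ℤ) ∣ W.frobeniusTrace p →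
    W.HasSurjectiveModNGaloisRep p →
    (∀ (ℓ : ℕ) [Fact ℓ.Prime], W.HasMultiplicativeReductionAtPrime ℓ →
      ¬ p ∣ padicValInt ℓ W.minimalDiscriminantInt) →
    (¬ W.IsSemistable ℤ → ∃ (ℓ₁ ℓ₂ : ℕ) (_ : Fact ℓ₁.Prime) (_ : Fact ℓ₂.Prime), ℓ₁ ≠ ℓ₂ ∧
      W.HasMultiplicativeReductionAtPrime ℓ₁ ∧ W.HasMultiplicativeReductionAtPrime ℓ₂) →
    ∀ (K : Type) [Field K] [NumberField K], IsImaginaryQuadratic K →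
      ∀ [NeZero (W.conductorNorm ℤ)], SatisfiesHeegnerHypothesis (W.conductorNorm ℤ) K →
      ¬ ((p : ℤ) ∣ NumberField.discr K) →
      ∃ (Dt : ModularParametrizationData W (W.conductorNorm ℤ)) (β : ℤ) (ι : K →+* ℂ) (n : ℕ)
        (d : KolyvaginHeegnerData Dt β ι n),
        KolyvaginDescent.KolSupp (Zhang2014.IsKolyvaginPrime (W.conductorNorm ℤ) W K p) n ∧
          (1 : ℕ∞) ≤ Zhang2014.levelIndex W p n ∧ d.kolyvaginClass hp.out 1 ≠ 0

/-! ### §2 The typed input + McCallum's Cor. 5.6 ⇒ STEP L (supersingular twin of the koly seat's STEP-0) -/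

section StepL

variable (W : WeierstrassCurve ℚ) [W.IsElliptic] [W.IsGloballyMinimal] [NeZero (W.conductorNorm ℤ)]
  (K : Type) [Field K] [NumberField K]

/-- **X7 ∧ r_an = 1, `p ≥ 5` supersingular: the typed input `ZhangKolyvaginNonvanishingSS` (`hZ`) and
McCallum 1991 Cor. 5.6 (`hMc`, cited fact) give STEP L.** For `W/ℚ` globally minimal, `p ≥ 5` good
with `p ∣ a_p`, `ρ̄_{E,p}` onto, ♠ at `N⁻ = 1` (every multiplicative `ℓ` has `p ∤ v_ℓ(Δ_min)`; if `N`
is not square-free, two multiplicative primes), `K` imaginary quadratic Heegner for `N_E` with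
`p ∤ d_K`; and, for the McCallum fact, `W` non-CM, `d_K ∉ {−3,−4}`, `ρ̄_{E,p^m}` onto for all `m`:
there is a normalisation `(Dt, β, ι)` such that for every `P ∈ E(K)` under `P_1`, of infinite order,
with `E(K)` of rank one without `p`-torsion, `Ш(E/K)` finite, `p^{M₀} ∥ P`:
`X11b.IndexLowerBoundAt W p K P` (`2·ord_p[E(K):ℤP] ≤ ord_p #Ш(E/K) + 2t`). Word for word the proof of
`Koly.exists_indexLowerBoundAt_of_zhang2014_of_mccallum` with `hord` replaced by `hss`. CONDITIONAL
on the typed input (OPEN) and the cited fact. [cite: McCallumLMS1991, §5 Cor. 5.6 (p. 310)]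
[cite: WZhang2014, Thm. 10.2 and Remark 5 (p. 199)] -/
theorem X7.exists_indexLowerBoundAt_of_zhangSS_of_mccallum
    (hZ : ZhangKolyvaginNonvanishingSS)
    (hMc : McCallum1991_pow_dvd_card_sha_primary_of_certificate)
    (p : ℕ) [hp : Fact p.Prime] (hp5 : 5 ≤ p) (hgood : W.HasGoodReductionAtPrime p)
    (hss : (p : ℤ) ∣ W.frobeniusTrace p) (hρ : W.HasSurjectiveModNGaloisRep p)
    (hram : ∀ (ℓ : ℕ) [Fact ℓ.Prime], W.HasMultiplicativeReductionAtPrime ℓ →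
      ¬ p ∣ padicValInt ℓ W.minimalDiscriminantInt)
    (htwo : ¬ W.IsSemistable ℤ → ∃ (ℓ₁ ℓ₂ : ℕ) (_ : Fact ℓ₁.Prime) (_ : Fact ℓ₂.Prime), ℓ₁ ≠ ℓ₂ ∧
      W.HasMultiplicativeReductionAtPrime ℓ₁ ∧ W.HasMultiplicativeReductionAtPrime ℓ₂)
    (hK : IsImaginaryQuadratic K) (hH : SatisfiesHeegnerHypothesis (W.conductorNorm ℤ) K)
    (hpd : ¬ ((p : ℤ) ∣ NumberField.discr K))
    (hCM : ¬ W.HasCM) (h3 : NumberField.discr K ≠ -3) (h4 : NumberField.discr K ≠ -4)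
    (hsurj : ∀ m : ℕ, W.HasSurjectiveModNGaloisRep (p ^ m : ℕ))
    (hrank : (W.baseChange K).mordellWeilRank = 1)
    (hiv : ∀ x : (W.baseChange K).toAffine.Point, p • x = 0 → x = 0)
    [Finite (W.baseChange K).sha] :
    ∃ (Dt : ModularParametrizationData W (W.conductorNorm ℤ)) (β : ℤ) (ι : K →+* ℂ),
      ∀ (d₁ : KolyvaginHeegnerData Dt β ι 1) (P : (W.baseChange K).toAffine.Point),
        d₁.toGeomPoints d₁.derivedPoint = toGeomPoints (W.baseChange K) P →
        ¬ IsOfFinAddOrder P →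
        ∀ (M₀ : ℕ), (∃ Q : (W.baseChange K).toAffine.Point, ((p ^ M₀ : ℕ) : ℤ) • Q = P) →
          (¬ ∃ Q : (W.baseChange K).toAffine.Point, ((p ^ (M₀ + 1) : ℕ) : ℤ) • Q = P) →
          X11b.IndexLowerBoundAt W p K P := by
  obtain ⟨Dt, β, ι, n, d, hn, -, hne⟩ :=
    hZ W p hp5 hgood hss hρ (fun ℓ _ hm ↦ hram ℓ hm) htwo K hK hH hpd
  have hp2 : p ≠ 2 := by omega
  exact ⟨Dt, β, ι, fun d₁ P hP hPinf M₀ hdiv hndiv ↦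
    indexLowerBoundAt_of_kolyvaginClass_one_ne_zero_of_mccallum W K hMc hCM hK h3 h4 hH p hp2 hsurj
      Dt β ι d₁ P hP hPinf hrank hiv hdiv hndiv d hn hne⟩

omit [NeZero (W.conductorNorm ℤ)] in
/-- **On X7 at `p ≥ 5` the supersingularity and tower hypotheses of the previous theorem are read
off the class**: `a_p = 0` (Hasse, `ClassX7.frobeniusTrace_eq_zero_of_five_le`), so `p ∣ a_p`; and
surj(p) gives `ρ̄_{E,p^m}` onto for all `m` (`ClassX7.towerSurj_of_surj`). Bookkeeping.
[cite: Serre1981, §8.1–8.2 (pp. 188–189)] [cite: SerreAbelianLadic1968, Ch. IV §3.4, Lemma 3 (IV-23)] -/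
theorem X7.dvd_frobeniusTrace_and_towerSurj (p : ℕ) [Fact p.Prime] (hp5 : 5 ≤ p)
    (hX : ClassX7 W p) (hs : Surj W p) :
    (p : ℤ) ∣ W.frobeniusTrace p ∧ ∀ m : ℕ, W.HasSurjectiveModNGaloisRep (p ^ m : ℕ) := by
  refine ⟨?_, fun m ↦ ClassX7.towerSurj_of_surj W p (by omega) hX hs m⟩
  rw [ClassX7.frobeniusTrace_eq_zero_of_five_le W p hp5 hX]
  exact dvd_zero _

end StepL

/-! ### §3 STEP L ⇒ the lower half of `BSD(E,p)` on X7 ∧ r_an = 1 ∧ p ≥ 5 ∧ surj(p) -/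

/-- **STEP L ⇒ the typed lower bound, at fixed Heegner data, on class X7 in rank one with
`ρ̄_{E,p}` onto.** Data: `W/ℚ` globally minimal of conductor `N`, `p ≥ 5`, `ClassX7 W p` (good
supersingular at `p`, `E` not semistable), `Surj W p` (a HYPOTHESIS here: `E` has an additive prime,
so Serre's Prop. 21 i) does not apply; irreducibility is automatic, `ClassX7.irr`), `ord_{s=1}L(E,s) = 1`;
`K` imaginary quadratic with every `ℓ ∣ N` split (the additive primes too) and `p` split, `p ∤ #𝓞_K^×`,
`L(E^{d_K},1) ≠ 0`; `P` the Heegner point of a datum `Dt` with `p ∤ c`; `Wd = Cd • E^{(d_K)}` a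
globally minimal model of the twist. PUBLISHED inputs by name exactly as in
`X6.missingLowerBoundAt_of_indexLowerBoundAt`: Gross–Zagier (`hGZ`), Kolyvagin (`hKo`), Wuthrich
2014 Prop. 21 for the twist (`hWu`; the twist is GOOD at `p` and `ρ̄_{E^{d_K},p}` is onto because
`ρ̄_{E,p}` is, `X11b.surj_twist_model`), GZK (`hGZK`), modularity (`hmod`); transports
`X11b.padicValNat_tamagawaProduct_twist_of_heegner` (`p ≥ 5`), `X11b.padicValRat_u_eq_zero_of_twist_good`.
TYPED input: STEP L `hL : X11b.IndexLowerBoundAt W p K P`. CONCLUSION: `Typed.MissingLowerBoundAt W p`.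
No rank-`0` EQUALITY for the twist is used; no semistability is used.
[cite: JetchevSkinnerWan2017, §7.4.1 (eq:shalowerK-1)–(eq:shalower), pp. 30–31 of arXiv:1512.06894]
[cite: Wuthrich2014, Prop. 21 (p. 400)] [cite: Serre1972, §1.11 Prop. 12] [cite: Miller2011LMS, Def. 1.1] -/
theorem X7.missingLowerBoundAt_of_indexLowerBoundAt_of_surj
    (W : WeierstrassCurve ℚ) [W.IsElliptic] [W.IsGloballyMinimal] (p : ℕ) [Fact p.Prime]
    [NeZero (W.conductorNorm ℤ)] (K : Type) [Field K] [NumberField K]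
    (Dt : ModularParametrizationData W (W.conductorNorm ℤ))
    (H : HeegnerDatum (W.conductorNorm ℤ) (NumberField.discr K)) (ι : K →+* ℂ)
    (P : (W.baseChange K).toAffine.Point)
    -- the published inputs (named facts of the tree)
    (hGZ : gross_zagier (W.conductorNorm ℤ) W K) (hKo : kolyvagin (W.conductorNorm ℤ) W K)
    (hWu : sha_dvd_analyticSha)
    (hGZK : rank_eq_analyticRank_of_analyticRank_le_one) (hmod : hasEntireLFunction_rat)
    -- the pair
    (hX : ClassX7 W p) (hs : Surj W p) (hr : W.analyticRank = 1) (hp5 : 5 ≤ p)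
    -- the Heegner data
    (hK : IsImaginaryQuadratic K) (hHN : SatisfiesHeegnerHypothesis (W.conductorNorm ℤ) K)
    (hHp : SatisfiesHeegnerHypothesis p K)
    (hP : WeierstrassCurve.Affine.Point.map ι.toRatAlgHom P = heegnerPointComplex Dt H)
    (hc : ¬ (p : ℤ) ∣ Dt.c) (hμ : ¬ p ∣ Units.torsionOrder K)
    (hLt : (W.quadraticTwist (NumberField.discr K : ℚ)).entireLFunction 1 ≠ 0)
    (Wd : WeierstrassCurve ℚ) [Wd.IsElliptic] [Wd.IsGloballyMinimal] (Cd : VariableChange ℚ)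
    (hWd : Cd • W.quadraticTwist (NumberField.discr K : ℚ) = Wd)
    -- STEP L (the typed input)
    (hL : X11b.IndexLowerBoundAt W p K P) :
    MissingLowerBoundAt W p := by
  have hp : p.Prime := Fact.out
  have hp2 : p ≠ 2 := by omega
  have hD0 : (NumberField.discr K : ℚ) ≠ 0 := by exact_mod_cast NumberField.discr_ne_zero K
  haveI hEt : (W.quadraticTwist (NumberField.discr K : ℚ)).IsElliptic :=
    W.isElliptic_quadraticTwist hD0
  have hgood : W.HasGoodReductionAtPrime p := hX.1.1
  -- `p ∤ d_K` (`p` splits in `K`)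
  have hpd : ¬ (p : ℤ) ∣ NumberField.discr K :=
    Literature.SatisfiesHeegnerHypothesis.not_dvd_discr hK.1 hHp hp dvd_rfl
  -- transports to the minimal twist model: good at `p`, surjective image, Tamagawa valuation, unit
  have hgoodd : Wd.HasGoodReductionAtPrime p := good_twist_model W p hp2 hpd hgood Cd hWd
  have hsurjd : Surj Wd p := X11b.surj_twist_model W p K hs Cd hWd
  have htam : padicValNat p Wd.tamagawaProduct = padicValNat p W.tamagawaProduct :=
    X11b.padicValNat_tamagawaProduct_twist_of_heegner W p hp5 K hK hHN Cd hWd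
  have hu : padicValRat p (Cd.u : ℚ) = 0 :=
    X11b.padicValRat_u_eq_zero_of_twist_good W p hpd hgood Cd hWd hgoodd
  -- the twist: `L(E^D,1) ≠ 0` and Wuthrich's `≤`-half
  have hLt' : (W.quadraticTwist (NumberField.discr K : ℚ)).entireLFunction = Wd.entireLFunction := by
    rw [← hWd, entireLFunction_smul]
  have hLd1 : Wd.entireLFunction 1 ≠ 0 := by rw [← hLt']; exact hLt
  have htw := twist_le_half_of_wuthrich_good hWu hGZK hmod Wd p hp2 hLd1 hgoodd hsurjd
  exact X11b.missingLowerBoundAt_of_indexLowerBoundAt W p (W.conductorNorm ℤ) K Dt H ι P hGZ hKo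
    hGZK hmod hK hHN hP hp2 hc hμ hr hLt Wd Cd hWd hu htam htw (fun _ ↦ hL)

/-- **STEP L ⇒ the typed lower bound on the whole of X7 ∧ {r_an = 1} ∧ {p ≥ 5} ∧ {surj(p)}**
(class level; the field and the datum discharged as in the X6 / row-C3 files). For every X7 pair
with `ord_{s=1} L(E,s) = 1`, `p ≥ 5` and `ρ̄_{E,p}` onto: the sign is `−1` (modularity `hnf`);
Friedberg–Hoffstein (`hFH`) gives an imaginary quadratic `K` with EVERY `ℓ ∣ N` split — the additive
primes included, no semistability needed —, `p` split, `|d_K| > 4` and `L(E^{d_K},1) ≠ 0`;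
`X11b.exists_maninDatum_of_good` (`hnf`, Mazur 1978 Cor. 4.1 `hMaz` — `p ∤ c` needs only `p` ODD
and GOOD, not semistability —, Néron `hNS`; `E[p]` irreducible is AUTOMATIC, `ClassX7.irr`) gives a
datum with `p ∤ c` and its Heegner point; a globally minimal model of the twist exists (AEC VIII.8.3).
Then `X7.missingLowerBoundAt_of_indexLowerBoundAt_of_surj`. TYPED input: STEP L at every such datum
(`hL`). CONCLUSION: `ord_p #Ш(E)_an ≤ ord_p #Ш(E)`. CONDITIONAL on STEP L; nothing booked.
[cite: JetchevSkinnerWan2017, §7.4.1 (pp. 29–31 of arXiv:1512.06894)]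
[cite: Wuthrich2014, Prop. 21 (p. 400)] [cite: Mazur1978, Cor. 4.1] [cite: Miller2011LMS, Def. 1.1] -/
theorem X7.missingLowerBoundAt_of_stepL_of_surj
    -- published inputs (named facts of the tree)
    (hGZ : ∀ (N : ℕ) [NeZero N] (W : WeierstrassCurve ℚ) (K : Type) [Field K] [NumberField K],
      gross_zagier N W K)
    (hKo : ∀ (N : ℕ) [NeZero N] (W : WeierstrassCurve ℚ) (K : Type) [Field K] [NumberField K],
      kolyvagin N W K)
    (hWu : sha_dvd_analyticSha)
    (hGZK : rank_eq_analyticRank_of_analyticRank_le_one) (hmod : hasEntireLFunction_rat)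
    (hnf : exists_isNewformOf)
    (hFH : friedbergHoffstein_exists_heegnerField_split_twist_ne_zero)
    (hMaz : mazur_not_dvd_maninConstant_of_odd) (hNS : integral_neronScaling_of_isGloballyMinimal)
    -- the typed input (STEP L) at every Manin-unit Heegner datum with `p` split in `K`
    (hL : ∀ (W : WeierstrassCurve ℚ) [W.IsElliptic] [W.IsGloballyMinimal] (p : ℕ) [Fact p.Prime]
      (N : ℕ) [NeZero N] (K : Type) [Field K] [NumberField K]
      (Dt : ModularParametrizationData W N) (H : HeegnerDatum N (NumberField.discr K)) (ι : K →+* ℂ)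
      (P : (W.baseChange K).toAffine.Point),
      ClassX7 W p → Surj W p → 5 ≤ p → W.analyticRank = 1 → W.conductorNorm ℤ = N →
      IsImaginaryQuadratic K → SatisfiesHeegnerHypothesis N K → SatisfiesHeegnerHypothesis p K →
      WeierstrassCurve.Affine.Point.map ι.toRatAlgHom P = heegnerPointComplex Dt H →
      ¬ (p : ℤ) ∣ Dt.c → X11b.IndexLowerBoundAt W p K P) :
    ∀ (W : WeierstrassCurve ℚ) [W.IsElliptic] [W.IsGloballyMinimal] (p : ℕ) [Fact p.Prime],
      ClassX7 W p → Surj W p → 5 ≤ p → W.analyticRank = 1 → MissingLowerBoundAt W p := by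
  intro W _ _ p _ hX hs hp5 hr
  have hp : p.Prime := Fact.out
  have hp2 : p ≠ 2 := by omega
  have hgood : W.HasGoodReductionAtPrime p := hX.1.1
  have hirr : Irr W p := ClassX7.irr W p hp2 hX
  haveI : NeZero (W.conductorNorm ℤ) := ⟨(W.conductorNorm_pos_holds).ne'⟩
  -- the sign of the functional equation is `−1` (modularity, `r_an = 1`)
  have hw : W.rootNumber = -1 := by
    rw [WeierstrassCurve.rootNumber_eq_neg_one_pow_analyticRank_of_exists_isNewformOf hnf W, hr]
    norm_num
  -- the auxiliary field (Friedberg–Hoffstein): every `ℓ ∣ N` split, `p` split, `|d_K| > 4`,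
  -- `L(E^{d_K},1) ≠ 0`
  obtain ⟨K, _, _, hK, hdisc, hHN, hHp, hLt⟩ := hFH W hw p hp 4
  -- `w_K = 2`, prime to `p ≥ 5`
  have hμ : ¬ p ∣ Units.torsionOrder K := by
    haveI : IsTotallyComplex K := hK.2
    have hneg : NumberField.discr K < 0 := discr_neg_of_finrank_eq_two K hK.1
    have habs : ((NumberField.discr K).natAbs : ℤ) = -NumberField.discr K :=
      Int.ofNat_natAbs_of_nonpos hneg.le
    have h4 : NumberField.discr K < -4 := by
      have : (4 : ℤ) < ((NumberField.discr K).natAbs : ℤ) := by exact_mod_cast hdisc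
      omega
    rw [Literature.NumberTheory.DiophantineGeometry.torsionOrder_eq_two_of_discr_lt hK.1 h4]
    intro h2
    have := Nat.le_of_dvd two_pos h2
    omega
  -- the Manin-unit Heegner datum at a good odd prime
  obtain ⟨Dt, H, ι, P, hP, hc⟩ :=
    X11b.exists_maninDatum_of_good hnf hMaz hNS W p (W.conductorNorm ℤ) K rfl hp2 hgood hirr hK hHN
  -- a globally minimal model of the twist (Silverman VIII.8 Cor. 8.3)
  have hD0 : (NumberField.discr K : ℚ) ≠ 0 := by exact_mod_cast NumberField.discr_ne_zero K
  haveI hEt : (W.quadraticTwist (NumberField.discr K : ℚ)).IsElliptic :=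
    W.isElliptic_quadraticTwist hD0
  obtain ⟨Cd, hCd⟩ := hasGlobalMinimalModel_rat_holds (W.quadraticTwist (NumberField.discr K : ℚ))
  haveI : (Cd • W.quadraticTwist (NumberField.discr K : ℚ)).IsGloballyMinimal := hCd
  have hWd : Cd • W.quadraticTwist (NumberField.discr K : ℚ) =
      Cd • W.quadraticTwist (NumberField.discr K : ℚ) := rfl
  exact X7.missingLowerBoundAt_of_indexLowerBoundAt_of_surj W p K Dt H ι P (hGZ _ W K) (hKo _ W K)
    hWu hGZK hmod hX hs hr hp5 hK hHN hHp hP hc hμ hLt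
    (Cd • W.quadraticTwist (NumberField.discr K : ℚ)) Cd hWd
    (hL W p _ K Dt H ι P hX hs hp5 hr rfl hK hHN hHp hP hc)

end Summit.BirchSwinnertonDyer.Rank1Residual.Supersingular

end
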